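import Literature.Probability.RandomPlanarGeometry.HullUniformizer
import HarnessLib

/-!
# Confocal ellipses via the Joukowski map: the smooth hulls for [LSW] Lemma 2.1

Proof infrastructure (no named facts; classical conformal mapping, all PROVED) for the outer
approximation of `+`-hulls by smooth hulls, [LSW] Lemma 2.1 —

* G. F. Lawler, O. Schramm, W. Werner, *Conformal restriction: the chordal case*, J. Amer. Math.
  Soc. **16** (2003), arXiv:math/0209343, Lemma 2.1 (p. 8: "The existence of the sequence `A_n`
  can be obtained by various means, for example, by considering the image under `Φ_A⁻¹` of
  appropriately chosen paths") and proof of Lemma 3.5 (p. 13, the neighbourhoods `D_δ` of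
  `[Φ_A(x₀), Φ_A(x₁)]`).

Our "appropriately chosen paths" are half-ellipses with foci at the endpoints of the segment,
because the Joukowski map `J(v) = v + v⁻¹` (`HullUniformizer.joukowski`) makes everything
explicit. In normalised coordinates (segment `[-2, 2]`):

* `focalSum u = ‖u - 2‖ + ‖u + 2‖` and **the identity `focalSum (J v) = 2(‖v‖ + ‖v‖⁻¹)`**
  (`focalSum_joukowski`): `J` maps the circle `‖v‖ = ρ` onto the ellipse with foci `±2`;
* `jEllipse ρ = {focalSum ≤ 2(ρ + ρ⁻¹)}`, `ρ ∈ (0, 1)`: compact, symmetric, NESTED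
  (`jEllipse_mono`), a neighbourhood of `[-2, 2]` (`mem_jEllipse_of_infDist_lt`), real points in
  `[-(ρ+ρ⁻¹), ρ+ρ⁻¹]`, and every point of `ℍ` is eventually outside (`eventually_notMem_jEllipse`);
* `J` maps `{‖v‖ < ρ, im v < 0}` bijectively onto `ℍ ∖ jEllipse ρ` (`bijOn_joukowski_lowerDisc`);
* the upper boundary arc `ellArc ρ t = J(ρ e^{-iπt})`, `t ∈ [0, 1]`: continuous, injective, real
  endpoints `±(ρ + ρ⁻¹)`, interior in `ℍ`, and
  **`ℍ ∩ ∂(jEllipse ρ) = ellArc ρ '' (0, 1)`** (`upperHalfPlaneSet_inter_frontier_jEllipse`);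
* the inverse branch `jInv = J⁻¹` on `W = J(𝔻 ∖ {0}) ⊇ ℍ ∪ {x real, |x| > 2}`, holomorphic with
  `(J⁻¹)' = (1 - (J⁻¹)⁻²)⁻¹` (`hasDerivAt_jInv`), `‖J⁻¹ u‖ < (‖u‖ - 1)⁻¹`;
* the normalised maps `jNorm ρ u = J⁻¹(u)/ρ² + 1/J⁻¹(u) = J(J⁻¹(u)/ρ)/ρ`: holomorphic on `W`,
  `ℍ ∖ jEllipse ρ → ℍ` bijectively (`bijOn_jNorm`), **`jNorm ρ u - u = J⁻¹(u)(ρ⁻² - 1)`**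
  (uniform closeness to the identity), `jNorm ρ u / u → 1` at `∞`, and at a real point
  `x < -(ρ + ρ⁻¹)`: `J⁻¹ x = v ∈ (-ρ, 0)` and `(jNorm ρ)'(x) = (1 - v²/ρ²)/(1 - v²)`
  (`jNorm_ofReal_data`).

The positioned half-ellipse hulls around a segment `[a, b] ⊆ (0, ∞)` and their restriction maps
are in `EllipseHulls`.
-/

noncomputable section

open Set Filter Topology Metric Bornology Complex
open UpperHalfPlane (upperHalfPlaneSet isOpen_upperHalfPlaneSet)
open scoped ComplexConjugate Real

namespace Literature.Probability.RandomPlanarGeometry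

/-! ### The focal sum `‖u - 2‖ + ‖u + 2‖` and the identity `f(J v) = 2(‖v‖ + ‖v‖⁻¹)` -/

/-- The **focal sum** `f(u) = ‖u - 2‖ + ‖u + 2‖`: the sum of the distances to the foci `±2` of the
Joukowski ellipses. [folklore] -/
def focalSum (u : ℂ) : ℝ := ‖u - 2‖ + ‖u + 2‖

/-- The focal sum is continuous. [folklore] -/
theorem continuous_focalSum : Continuous focalSum := by
  unfold focalSum
  fun_prop

/-- `f ≥ 4` (triangle inequality between the foci). [folklore] -/
theorem four_le_focalSum (u : ℂ) : 4 ≤ focalSum u := by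
  have h : ‖(u + 2) - (u - 2)‖ ≤ ‖u + 2‖ + ‖u - 2‖ := norm_sub_le _ _
  have h4 : ‖(u + 2) - (u - 2)‖ = 4 := by
    rw [show (u + 2) - (u - 2) = (4 : ℂ) by ring]
    norm_num
  rw [focalSum]
  linarith

/-- `f` is `2`-Lipschitz: `f(u) ≤ f(s) + 2 ‖u - s‖`. [folklore] -/
theorem focalSum_le_add (u s : ℂ) : focalSum u ≤ focalSum s + 2 * ‖u - s‖ := by
  have h1 : ‖u - 2‖ ≤ ‖u - s‖ + ‖s - 2‖ := by
    calc ‖u - 2‖ = ‖(u - s) + (s - 2)‖ := by ring_nf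
      _ ≤ ‖u - s‖ + ‖s - 2‖ := norm_add_le _ _
  have h2 : ‖u + 2‖ ≤ ‖u - s‖ + ‖s + 2‖ := by
    calc ‖u + 2‖ = ‖(u - s) + (s + 2)‖ := by ring_nf
      _ ≤ ‖u - s‖ + ‖s + 2‖ := norm_add_le _ _
  rw [focalSum, focalSum]
  linarith

/-- `2 ‖u‖ ≤ f(u)`. [folklore] -/
theorem two_mul_norm_le_focalSum (u : ℂ) : 2 * ‖u‖ ≤ focalSum u := by
  have h : ‖(u - 2) + (u + 2)‖ ≤ ‖u - 2‖ + ‖u + 2‖ := norm_add_le _ _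
  have h2 : ‖(u - 2) + (u + 2)‖ = 2 * ‖u‖ := by
    rw [show (u - 2) + (u + 2) = (2 : ℂ) * u by ring, norm_mul]
    norm_num
  rw [focalSum]
  linarith

/-- For a real point, `2 |x| ≤ f(x)`, so `f(x) ≤ 2c ⇒ |x| ≤ c`. [folklore] -/
theorem abs_le_of_focalSum_ofReal_le {x c : ℝ} (h : focalSum x ≤ 2 * c) : |x| ≤ c := by
  have := two_mul_norm_le_focalSum (x : ℂ)
  rw [norm_real, Real.norm_eq_abs] at this
  linarith

/-- On the real segment `[-2, 2]` the focal sum is `4`. [folklore] -/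
theorem focalSum_ofReal_of_abs_le {x : ℝ} (hx : |x| ≤ 2) : focalSum x = 4 := by
  rw [focalSum, show (x : ℂ) - 2 = ((x - 2 : ℝ) : ℂ) by push_cast; ring,
    show (x : ℂ) + 2 = ((x + 2 : ℝ) : ℂ) by push_cast; ring, norm_real, norm_real,
    Real.norm_eq_abs, Real.norm_eq_abs, abs_le] at *
  rw [abs_of_nonpos (by linarith [hx.2]), abs_of_nonneg (by linarith [hx.1])]
  ring

/-- `f` is conjugation-invariant. [folklore] -/
theorem focalSum_conj (u : ℂ) : focalSum (conj u) = focalSum u := by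
  rw [focalSum, focalSum, show conj u - 2 = conj (u - 2) by simp [map_sub, map_ofNat],
    show conj u + 2 = conj (u + 2) by simp [map_add, map_ofNat], norm_conj, norm_conj]

/-- `J(v) - 2 = (v - 1)² / v`. [folklore] -/
theorem joukowski_sub_two {v : ℂ} (hv : v ≠ 0) : joukowski v - 2 = (v - 1) ^ 2 / v := by
  rw [joukowski]
  field_simp
  ring

/-- `J(v) + 2 = (v + 1)² / v`. [folklore] -/
theorem joukowski_add_two {v : ℂ} (hv : v ≠ 0) : joukowski v + 2 = (v + 1) ^ 2 / v := by
  rw [joukowski]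
  field_simp
  ring

/-- **The focal-sum identity** `‖J v - 2‖ + ‖J v + 2‖ = 2 (‖v‖ + ‖v‖⁻¹)`: the Joukowski map sends
the circle `‖v‖ = r` onto the ellipse with foci `±2` and focal sum `2(r + r⁻¹)`. [folklore] -/
theorem focalSum_joukowski {v : ℂ} (hv : v ≠ 0) : focalSum (joukowski v) = 2 * (‖v‖ + ‖v‖⁻¹) := by
  have hv' : 0 < ‖v‖ := norm_pos_iff.2 hv
  rw [focalSum, joukowski_sub_two hv, joukowski_add_two hv, norm_div, norm_div, norm_pow, norm_pow,
    ← add_div]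
  have key : ‖v - 1‖ ^ 2 + ‖v + 1‖ ^ 2 = 2 * ‖v‖ ^ 2 + 2 := by
    rw [← normSq_eq_norm_sq, ← normSq_eq_norm_sq, ← normSq_eq_norm_sq, normSq_sub, normSq_add]
    simp
    ring
  rw [key]
  field_simp

/-! ### The level `ρ + ρ⁻¹` -/

/-- The level `ρ + ρ⁻¹` (half the focal sum of the ellipse `J(‖v‖ = ρ)`). [folklore] -/
def jLevel (ρ : ℝ) : ℝ := ρ + ρ⁻¹

/-- `jLevel 1 = 2`. [folklore] -/
@[simp] theorem jLevel_one : jLevel 1 = 2 := by norm_num [jLevel]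

/-- The focal-sum identity in terms of `jLevel`. [folklore] -/
theorem focalSum_joukowski_eq {v : ℂ} (hv : v ≠ 0) : focalSum (joukowski v) = 2 * jLevel ‖v‖ :=
  focalSum_joukowski hv

/-- `ρ + ρ⁻¹` is strictly decreasing on `(0, 1]`. [folklore] -/
theorem jLevel_lt_jLevel {r s : ℝ} (hr : 0 < r) (hrs : r < s) (hs : s ≤ 1) : jLevel s < jLevel r := by
  rw [jLevel, jLevel]
  have hs0 : 0 < s := hr.trans hrs
  have h1 : r⁻¹ - s⁻¹ = (s - r) / (r * s) := by field_simp
  have h2 : 1 < (r * s)⁻¹ := by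
    rw [one_lt_inv₀ (mul_pos hr hs0)]
    nlinarith
  have h3 : (s - r) < (s - r) / (r * s) := by
    rw [div_eq_mul_inv]
    nlinarith
  linarith

/-- `ρ + ρ⁻¹` is antitone on `(0, 1]`. [folklore] -/
theorem jLevel_le_jLevel {r s : ℝ} (hr : 0 < r) (hrs : r ≤ s) (hs : s ≤ 1) : jLevel s ≤ jLevel r := by
  rcases hrs.lt_or_eq with h | h
  · exact (jLevel_lt_jLevel hr h hs).le
  · rw [h]

/-- On `(0, 1]`: `jLevel s ≤ jLevel r ↔ r ≤ s`. [folklore] -/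
theorem jLevel_le_jLevel_iff {r s : ℝ} (hr : 0 < r) (hr1 : r ≤ 1) (hs : 0 < s) (hs1 : s ≤ 1) :
    jLevel s ≤ jLevel r ↔ r ≤ s := by
  constructor
  · intro h
    by_contra hlt
    push Not at hlt
    exact absurd h (not_le.2 (jLevel_lt_jLevel hs hlt hr1))
  · intro h
    exact jLevel_le_jLevel hr h hs1

/-- On `(0, 1]`: `jLevel s = jLevel r ↔ r = s`. [folklore] -/
theorem jLevel_injOn : InjOn jLevel (Ioc 0 1) := by
  intro r hr s hs h
  exact le_antisymm ((jLevel_le_jLevel_iff hr.1 hr.2 hs.1 hs.2).1 h.symm.le)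
    ((jLevel_le_jLevel_iff hs.1 hs.2 hr.1 hr.2).1 h.le)

/-- `2 < ρ + ρ⁻¹` for `ρ ∈ (0, 1)`. [folklore] -/
theorem two_lt_jLevel {ρ : ℝ} (h0 : 0 < ρ) (h1 : ρ < 1) : 2 < jLevel ρ := by
  have := jLevel_lt_jLevel h0 h1 le_rfl
  rwa [jLevel_one] at this

/-- `2 ≤ ρ + ρ⁻¹` for `ρ ∈ (0, 1]`. [folklore] -/
theorem two_le_jLevel {ρ : ℝ} (h0 : 0 < ρ) (h1 : ρ ≤ 1) : 2 ≤ jLevel ρ := by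
  have := jLevel_le_jLevel h0 h1 le_rfl
  rwa [jLevel_one] at this

/-- `ρ < ρ + ρ⁻¹`. [folklore] -/
theorem lt_jLevel {ρ : ℝ} (h0 : 0 < ρ) : ρ < jLevel ρ := by
  rw [jLevel]
  have := inv_pos.2 h0
  linarith

/-- `ρ + ρ⁻¹ → 2` as `ρ → 1`. [folklore] -/
theorem tendsto_jLevel_one : Tendsto jLevel (𝓝 1) (𝓝 2) := by
  have : ContinuousAt jLevel 1 := by
    unfold jLevel
    exact continuousAt_id.add (continuousAt_inv₀ one_ne_zero)
  simpa using this.tendsto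

/-! ### The Joukowski ellipses -/

/-- **The Joukowski ellipse** `N(ρ) = {u : ‖u - 2‖ + ‖u + 2‖ ≤ 2(ρ + ρ⁻¹)}`, `ρ ∈ (0, 1)`: the closed
region bounded by the image of the circle `‖v‖ = ρ` under `J(v) = v + v⁻¹` (an ellipse with foci
`±2`, semi-axes `ρ⁻¹ ± ρ`). As `ρ ↑ 1` these decrease to the segment `[-2, 2]`. [folklore] -/
def jEllipse (ρ : ℝ) : Set ℂ := {u | focalSum u ≤ 2 * jLevel ρ}

/-- Membership in the ellipse. [folklore] -/
theorem mem_jEllipse_iff {ρ : ℝ} {u : ℂ} : u ∈ jEllipse ρ ↔ focalSum u ≤ 2 * jLevel ρ := Iff.rfl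

/-- The ellipse is closed. [folklore] -/
theorem isClosed_jEllipse (ρ : ℝ) : IsClosed (jEllipse ρ) :=
  isClosed_le continuous_focalSum continuous_const

/-- Points of the ellipse have norm at most the level. [folklore] -/
theorem norm_le_of_mem_jEllipse {ρ : ℝ} {u : ℂ} (hu : u ∈ jEllipse ρ) : ‖u‖ ≤ jLevel ρ := by
  have := two_mul_norm_le_focalSum u
  rw [mem_jEllipse_iff] at hu
  linarith

/-- The ellipse is bounded. [folklore] -/
theorem isBounded_jEllipse (ρ : ℝ) : IsBounded (jEllipse ρ) :=
  (isBounded_closedBall (x := (0 : ℂ)) (r := jLevel ρ)).subset fun _ hu ↦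
    mem_closedBall_zero_iff.2 (norm_le_of_mem_jEllipse hu)

/-- The ellipse is compact. [folklore] -/
theorem isCompact_jEllipse (ρ : ℝ) : IsCompact (jEllipse ρ) :=
  Metric.isCompact_of_isClosed_isBounded (isClosed_jEllipse ρ) (isBounded_jEllipse ρ)

/-- The ellipse is conjugation-invariant. [folklore] -/
theorem conj_mem_jEllipse_iff {ρ : ℝ} {u : ℂ} : conj u ∈ jEllipse ρ ↔ u ∈ jEllipse ρ := by
  rw [mem_jEllipse_iff, mem_jEllipse_iff, focalSum_conj]

/-- **The ellipses are nested**: `N(s) ⊆ N(r)` for `r ≤ s` in `(0, 1]`. [folklore] -/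
theorem jEllipse_mono {r s : ℝ} (hr : 0 < r) (hrs : r ≤ s) (hs : s ≤ 1) : jEllipse s ⊆ jEllipse r :=
  fun u hu ↦ le_trans (mem_jEllipse_iff.1 hu) (by linarith [jLevel_le_jLevel hr hrs hs])

/-- Real points of the ellipse satisfy `|x| ≤ ρ + ρ⁻¹`. [folklore] -/
theorem abs_le_jLevel_of_ofReal_mem_jEllipse {ρ x : ℝ} (hx : (x : ℂ) ∈ jEllipse ρ) : |x| ≤ jLevel ρ :=
  abs_le_of_focalSum_ofReal_le hx

/-- **The ellipse is a neighbourhood of `[-2, 2]`**: the `δ`-neighbourhood of the segment lies in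
`N(ρ)` for `δ ≤ ρ + ρ⁻¹ - 2`. [folklore] -/
theorem mem_jEllipse_of_infDist_lt {ρ δ : ℝ} (hδ : δ ≤ jLevel ρ - 2) {u : ℂ}
    (hu : infDist u (realSeg (-2) 2) < δ) : u ∈ jEllipse ρ := by
  have hne : (realSeg (-2) 2).Nonempty := ⟨0, ofReal_mem_realSeg.2 (by norm_num [uIcc_of_le])⟩
  obtain ⟨s, hs, hus⟩ := (infDist_lt_iff hne).1 hu
  obtain ⟨x, hx, rfl⟩ := hs
  rw [uIcc_of_le (by norm_num : (-2 : ℝ) ≤ 2)] at hx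
  have hfx : focalSum x = 4 := focalSum_ofReal_of_abs_le (abs_le.2 ⟨hx.1, hx.2⟩)
  have := focalSum_le_add u x
  rw [hfx, ← dist_eq_norm] at this
  rw [mem_jEllipse_iff]
  linarith

/-- The segment `[-2, 2]` lies in every ellipse `N(ρ)`, `ρ ∈ (0, 1]`. [folklore] -/
theorem realSeg_subset_jEllipse {ρ : ℝ} (h0 : 0 < ρ) (h1 : ρ ≤ 1) : realSeg (-2) 2 ⊆ jEllipse ρ := by
  rintro _ ⟨x, hx, rfl⟩
  rw [uIcc_of_le (by norm_num : (-2 : ℝ) ≤ 2)] at hx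
  rw [mem_jEllipse_iff, focalSum_ofReal_of_abs_le (abs_le.2 ⟨hx.1, hx.2⟩)]
  linarith [two_le_jLevel h0 h1]

/-- **Points `J(v)` of the punctured disc lie in `N(ρ)` iff `ρ ≤ ‖v‖`.** [folklore] -/
theorem joukowski_mem_jEllipse_iff {ρ : ℝ} (h0 : 0 < ρ) (h1 : ρ ≤ 1) {v : ℂ} (hv0 : v ≠ 0) (hv1 : ‖v‖ < 1) :
    joukowski v ∈ jEllipse ρ ↔ ρ ≤ ‖v‖ := by
  rw [mem_jEllipse_iff, focalSum_joukowski_eq hv0]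
  constructor
  · intro h
    exact (jLevel_le_jLevel_iff h0 h1 (norm_pos_iff.2 hv0) hv1.le).1 (by linarith)
  · intro h
    linarith [jLevel_le_jLevel h0 h hv1.le]

/-- `J(v)` is on the boundary ellipse `{f = 2(ρ + ρ⁻¹)}` iff `‖v‖ = ρ` (for `v` in the punctured disc). [folklore] -/
theorem focalSum_joukowski_eq_iff {ρ : ℝ} (h0 : 0 < ρ) (h1 : ρ ≤ 1) {v : ℂ} (hv0 : v ≠ 0) (hv1 : ‖v‖ < 1) :
    focalSum (joukowski v) = 2 * jLevel ρ ↔ ‖v‖ = ρ := by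
  rw [focalSum_joukowski_eq hv0]
  constructor
  · intro h
    exact jLevel_injOn ⟨norm_pos_iff.2 hv0, hv1.le⟩ ⟨h0, h1⟩ (by linarith)
  · intro h
    rw [h]

/-! ### Lower discs and the bijection `J : {‖v‖ < ρ, im v < 0} → ℍ ∖ N(ρ)` -/

/-- The lower open half-disc of radius `ρ`. [folklore] -/
def lowerDisc (ρ : ℝ) : Set ℂ := {v | ‖v‖ < ρ ∧ v.im < 0}

/-- `lowerDisc ρ ⊆ lowerHalfDisc` for `ρ ≤ 1`. [folklore] -/
theorem lowerDisc_subset_lowerHalfDisc {ρ : ℝ} (h1 : ρ ≤ 1) : lowerDisc ρ ⊆ lowerHalfDisc :=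
  fun _ hv ↦ ⟨lt_of_lt_of_le hv.1 h1, hv.2⟩

/-- `lowerDisc 1 = lowerHalfDisc`. [folklore] -/
theorem lowerDisc_one : lowerDisc 1 = lowerHalfDisc := rfl

/-- Points of a lower disc are nonzero. [folklore] -/
theorem ne_zero_of_mem_lowerDisc {ρ : ℝ} {v : ℂ} (hv : v ∈ lowerDisc ρ) : v ≠ 0 := by
  rintro rfl
  exact absurd hv.2 (by simp)

/-- The lower disc is open. [folklore] -/
theorem isOpen_lowerDisc (ρ : ℝ) : IsOpen (lowerDisc ρ) :=
  (isOpen_lt continuous_norm continuous_const).inter (isOpen_lt continuous_im continuous_const)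

/-- **`J` maps the lower disc of radius `ρ` bijectively onto `ℍ ∖ N(ρ)`.** [folklore] -/
theorem bijOn_joukowski_lowerDisc {ρ : ℝ} (h0 : 0 < ρ) (h1 : ρ ≤ 1) :
    BijOn joukowski (lowerDisc ρ) (upperHalfPlaneSet \ jEllipse ρ) := by
  refine ⟨fun v hv ↦ ⟨mapsTo_joukowski (lowerDisc_subset_lowerHalfDisc h1 hv), fun h ↦ ?_⟩,
    injOn_joukowski.mono ((lowerDisc_subset_lowerHalfDisc h1).trans lowerHalfDisc_subset), fun u hu ↦ ?_⟩
  · have := (joukowski_mem_jEllipse_iff h0 h1 (ne_zero_of_mem_lowerDisc hv) (lt_of_lt_of_le hv.1 h1)).1 h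
    linarith [hv.1]
  · obtain ⟨v, hv, rfl⟩ := surjOn_joukowski hu.1
    refine ⟨v, ⟨?_, hv.2⟩, rfl⟩
    by_contra hle
    push Not at hle
    exact hu.2 ((joukowski_mem_jEllipse_iff h0 h1 (lowerHalfDisc_subset hv).2 hv.1).2 hle)

/-! ### The upper boundary arc `θ ↦ J(ρ e^{-iπt})` of `N(ρ)` -/

/-- The point `ρ e^{-iπt}` of the circle of radius `ρ` (lower semicircle for `t ∈ (0, 1)`). [folklore] -/
def circPt (ρ t : ℝ) : ℂ := ρ * exp (((-(π * t) : ℝ) : ℂ) * I)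

/-- `‖ρ e^{-iπt}‖ = ρ`. [folklore] -/
theorem norm_circPt {ρ : ℝ} (h0 : 0 ≤ ρ) (t : ℝ) : ‖circPt ρ t‖ = ρ := by
  rw [circPt, norm_mul, norm_exp_ofReal_mul_I, mul_one, norm_real, Real.norm_of_nonneg h0]

/-- `im (ρ e^{-iπt}) = -ρ sin(πt)`. [folklore] -/
theorem circPt_im (ρ t : ℝ) : (circPt ρ t).im = -(ρ * Real.sin (π * t)) := by
  rw [circPt, mul_im, ofReal_re, ofReal_im, zero_mul, add_zero, exp_ofReal_mul_I_im, Real.sin_neg]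
  ring

/-- `re (ρ e^{-iπt}) = ρ cos(πt)`. [folklore] -/
theorem circPt_re (ρ t : ℝ) : (circPt ρ t).re = ρ * Real.cos (π * t) := by
  rw [circPt, mul_re, ofReal_re, ofReal_im, zero_mul, sub_zero, exp_ofReal_mul_I_re, Real.cos_neg]

/-- `normSq (ρ e^{-iπt}) = ρ²`. [folklore] -/
theorem normSq_circPt {ρ : ℝ} (h0 : 0 ≤ ρ) (t : ℝ) : normSq (circPt ρ t) = ρ ^ 2 := by
  rw [normSq_eq_norm_sq, norm_circPt h0]

/-- `ρ e^{-iπt} ≠ 0` for `ρ ≠ 0`. [folklore] -/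
theorem circPt_ne_zero {ρ : ℝ} (h0 : 0 < ρ) (t : ℝ) : circPt ρ t ≠ 0 := by
  intro h
  have := norm_circPt h0.le t
  rw [h, norm_zero] at this
  linarith

/-- For `t ∈ (0, 1)`, `ρ e^{-iπt}` lies in the open lower half-plane. [folklore] -/
theorem circPt_im_neg {ρ : ℝ} (h0 : 0 < ρ) {t : ℝ} (ht : t ∈ Ioo (0 : ℝ) 1) : (circPt ρ t).im < 0 := by
  rw [circPt_im]
  have : 0 < Real.sin (π * t) :=
    Real.sin_pos_of_pos_of_lt_pi (by nlinarith [Real.pi_pos, ht.1]) (by nlinarith [Real.pi_pos, ht.2])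
  nlinarith

/-- `t ↦ ρ e^{-iπt}` is continuous. [folklore] -/
theorem continuous_circPt (ρ : ℝ) : Continuous (circPt ρ) := by
  unfold circPt
  fun_prop

/-- **The upper boundary arc** `β_ρ(t) = J(ρ e^{-iπt})`, `t ∈ [0, 1]`, of the ellipse `N(ρ)`: from
`ρ + ρ⁻¹` (at `t = 0`) through `ℍ` to `-(ρ + ρ⁻¹)` (at `t = 1`). [folklore] -/
def ellArc (ρ t : ℝ) : ℂ := joukowski (circPt ρ t)

/-- `im β_ρ(t) = (ρ⁻¹ - ρ) sin(πt)`. [folklore] -/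
theorem ellArc_im {ρ : ℝ} (h0 : 0 < ρ) (t : ℝ) : (ellArc ρ t).im = (ρ⁻¹ - ρ) * Real.sin (π * t) := by
  rw [ellArc, joukowski_im, circPt_im, normSq_circPt h0.le]
  field_simp
  ring

/-- `re β_ρ(t) = (ρ + ρ⁻¹) cos(πt)`. [folklore] -/
theorem ellArc_re {ρ : ℝ} (h0 : 0 < ρ) (t : ℝ) : (ellArc ρ t).re = jLevel ρ * Real.cos (π * t) := by
  rw [ellArc, joukowski, add_re, inv_re, circPt_re, normSq_circPt h0.le, jLevel]
  field_simp

/-- `β_ρ(0) = ρ + ρ⁻¹`. [folklore] -/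
theorem ellArc_zero {ρ : ℝ} (h0 : 0 < ρ) : ellArc ρ 0 = (jLevel ρ : ℂ) :=
  Complex.ext (by simp [ellArc_re h0]) (by simp [ellArc_im h0])

/-- `β_ρ(1) = -(ρ + ρ⁻¹)`. [folklore] -/
theorem ellArc_one {ρ : ℝ} (h0 : 0 < ρ) : ellArc ρ 1 = ((-jLevel ρ : ℝ) : ℂ) :=
  Complex.ext (by simp [ellArc_re h0]) (by simp [ellArc_im h0])

/-- For `t ∈ (0, 1)` and `ρ ∈ (0, 1)`, `β_ρ(t) ∈ ℍ`. [folklore] -/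
theorem ellArc_im_pos {ρ : ℝ} (h0 : 0 < ρ) (h1 : ρ < 1) {t : ℝ} (ht : t ∈ Ioo (0 : ℝ) 1) : 0 < (ellArc ρ t).im := by
  rw [ellArc_im h0]
  have hs : 0 < Real.sin (π * t) :=
    Real.sin_pos_of_pos_of_lt_pi (by nlinarith [Real.pi_pos, ht.1]) (by nlinarith [Real.pi_pos, ht.2])
  have : ρ < ρ⁻¹ := by
    have h2 : 1 < ρ⁻¹ := (one_lt_inv₀ h0).2 h1
    linarith
  exact mul_pos (by linarith) hs

/-- `β_ρ(0), β_ρ(1)` are real. [folklore] -/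
theorem ellArc_im_eq_zero {ρ : ℝ} (h0 : 0 < ρ) {t : ℝ} (ht : t = 0 ∨ t = 1) : (ellArc ρ t).im = 0 := by
  rcases ht with rfl | rfl
  · simp [ellArc_im h0]
  · simp [ellArc_im h0]

/-- The arc is continuous. [folklore] -/
theorem continuous_ellArc {ρ : ℝ} (h0 : 0 < ρ) : Continuous (ellArc ρ) :=
  continuousOn_joukowski.comp_continuous (continuous_circPt ρ) fun t ↦ circPt_ne_zero h0 t

/-- **The arc is injective on `[0, 1]`** (its real part is `(ρ + ρ⁻¹) cos(πt)`). [folklore] -/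
theorem injOn_ellArc {ρ : ℝ} (h0 : 0 < ρ) : InjOn (ellArc ρ) (Icc 0 1) := by
  intro s hs t ht hst
  have hre := congrArg Complex.re hst
  rw [ellArc_re h0, ellArc_re h0] at hre
  have hL : jLevel ρ ≠ 0 := (h0.trans (lt_jLevel h0)).ne'
  have hcos : Real.cos (π * s) = Real.cos (π * t) := mul_left_cancel₀ hL hre
  have hs' : π * s ∈ Icc 0 π := ⟨by nlinarith [Real.pi_pos, hs.1], by nlinarith [Real.pi_pos, hs.2]⟩
  have ht' : π * t ∈ Icc 0 π := ⟨by nlinarith [Real.pi_pos, ht.1], by nlinarith [Real.pi_pos, ht.2]⟩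
  have := Real.injOn_cos hs' ht' hcos
  exact mul_left_cancel₀ Real.pi_pos.ne' this

/-- **The arc lies on the boundary ellipse**: `f(β_ρ(t)) = 2(ρ + ρ⁻¹)`. [folklore] -/
theorem focalSum_ellArc {ρ : ℝ} (h0 : 0 < ρ) (t : ℝ) : focalSum (ellArc ρ t) = 2 * jLevel ρ := by
  rw [ellArc, focalSum_joukowski_eq (circPt_ne_zero h0 t), norm_circPt h0.le]

/-- The arc lies in `N(ρ)`. [folklore] -/
theorem ellArc_mem_jEllipse {ρ : ℝ} (h0 : 0 < ρ) (t : ℝ) : ellArc ρ t ∈ jEllipse ρ := by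
  rw [mem_jEllipse_iff, focalSum_ellArc h0]

/-- **The arc is not interior to `N(ρ)`**: the points `J((1 - s) ρ e^{-iπt})`, `s ↓ 0`, converge to
`β_ρ(t)` from outside `N(ρ)`. [folklore] -/
theorem ellArc_notMem_interior {ρ : ℝ} (h0 : 0 < ρ) (h1 : ρ ≤ 1) (t : ℝ) : ellArc ρ t ∉ interior (jEllipse ρ) := by
  intro hint
  -- the approach `s ↦ J((1 - s) ρ e^{-iπt})`, `s → 0⁺`
  have hv0 : circPt ρ t ≠ 0 := circPt_ne_zero h0 t
  have hcont : Tendsto (fun s : ℝ ↦ joukowski ((1 - s : ℝ) * circPt ρ t)) (𝓝[>] 0) (𝓝 (ellArc ρ t)) := by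
    have h1' : Tendsto (fun s : ℝ ↦ ((1 - s : ℝ) : ℂ) * circPt ρ t) (𝓝 0) (𝓝 (circPt ρ t)) := by
      have : Continuous fun s : ℝ ↦ ((1 - s : ℝ) : ℂ) * circPt ρ t := by fun_prop
      simpa using this.tendsto 0
    have h2 : ContinuousAt joukowski (circPt ρ t) := (differentiableAt_joukowski hv0).continuousAt
    exact (h2.tendsto.comp h1').mono_left nhdsWithin_le_nhds
  have hev : ∀ᶠ s : ℝ in 𝓝[>] 0, joukowski ((1 - s : ℝ) * circPt ρ t) ∈ interior (jEllipse ρ) :=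
    hcont (isOpen_interior.mem_nhds hint)
  have hev2 : ∀ᶠ s : ℝ in 𝓝[>] 0, s < 1 := nhdsWithin_le_nhds (Iio_mem_nhds one_pos)
  have hev3 : ∀ᶠ s : ℝ in 𝓝[>] 0, (0 : ℝ) < s := self_mem_nhdsWithin
  obtain ⟨s, hs, hs0, hs1⟩ := (hev.and (hev3.and hev2)).exists
  have hs0' : (0 : ℝ) < s := hs0
  -- but this point is outside `N(ρ)`
  have hmem := interior_subset hs
  have hw0 : ((1 - s : ℝ) : ℂ) * circPt ρ t ≠ 0 := mul_ne_zero (by exact_mod_cast (by linarith : (1 - s : ℝ) ≠ 0)) hv0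
  have hnorm : ‖((1 - s : ℝ) : ℂ) * circPt ρ t‖ = (1 - s) * ρ := by
    rw [norm_mul, norm_real, Real.norm_of_nonneg (by linarith), norm_circPt h0.le]
  have hlt1 : ‖((1 - s : ℝ) : ℂ) * circPt ρ t‖ < 1 := by
    rw [hnorm]; nlinarith
  have := (joukowski_mem_jEllipse_iff h0 h1 hw0 hlt1).1 hmem
  rw [hnorm] at this
  nlinarith

/-- **Every point of `ℍ` on the boundary ellipse is on the arc**: `ζ = J(v)` with `‖v‖ = ρ`,
`im v < 0`, and `v = ρ e^{i arg v}`, `arg v ∈ (-π, 0)`. [folklore] -/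
theorem exists_ellArc_eq {ρ : ℝ} (h0 : 0 < ρ) (h1 : ρ ≤ 1) {ζ : ℂ} (hζ : 0 < ζ.im)
    (hf : focalSum ζ = 2 * jLevel ρ) : ∃ t ∈ Ioo (0 : ℝ) 1, ellArc ρ t = ζ := by
  obtain ⟨v, hv, rfl⟩ := surjOn_joukowski (show ζ ∈ upperHalfPlaneSet from hζ)
  have hv0 : v ≠ 0 := (lowerHalfDisc_subset hv).2
  have hnorm : ‖v‖ = ρ := (focalSum_joukowski_eq_iff h0 h1 hv0 hv.1).1 hf
  have harg : arg v < 0 := Complex.arg_neg_iff.2 hv.2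
  have hargπ : -π < arg v := Complex.neg_pi_lt_arg v
  refine ⟨-arg v / π, ⟨div_pos (by linarith) Real.pi_pos, by rw [div_lt_one Real.pi_pos]; linarith⟩, ?_⟩
  rw [ellArc]
  congr 1
  rw [circPt, show -(π * (-arg v / π)) = arg v by field_simp, ← hnorm]
  exact norm_mul_exp_arg_mul_I v

/-- For `ζ ∈ ℍ`: `ζ` is interior to `N(ρ)` iff `f(ζ) < 2(ρ + ρ⁻¹)`. [folklore] -/
theorem mem_interior_jEllipse_iff_of_im_pos {ρ : ℝ} (h0 : 0 < ρ) (h1 : ρ ≤ 1) {ζ : ℂ} (hζ : 0 < ζ.im) :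
    ζ ∈ interior (jEllipse ρ) ↔ focalSum ζ < 2 * jLevel ρ := by
  constructor
  · intro h
    rcases (mem_jEllipse_iff.1 (interior_subset h)).lt_or_eq with hlt | heq
    · exact hlt
    · exfalso
      obtain ⟨t, -, rfl⟩ := exists_ellArc_eq h0 h1 hζ heq
      exact ellArc_notMem_interior h0 h1 t h
  · intro h
    exact interior_maximal (fun u (hu : focalSum u < 2 * jLevel ρ) ↦ mem_jEllipse_iff.2 hu.le)
      (isOpen_lt continuous_focalSum continuous_const) h

/-- **The part of `∂N(ρ)` in `ℍ` is the open arc `β_ρ(0, 1)`.** [folklore] -/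
theorem upperHalfPlaneSet_inter_frontier_jEllipse {ρ : ℝ} (h0 : 0 < ρ) (h1 : ρ < 1) :
    upperHalfPlaneSet ∩ frontier (jEllipse ρ) = ellArc ρ '' Ioo 0 1 := by
  ext ζ
  constructor
  · rintro ⟨hζ, hfr⟩
    rw [(isClosed_jEllipse ρ).frontier_eq] at hfr
    obtain ⟨hmem, hnint⟩ := hfr
    have heq : focalSum ζ = 2 * jLevel ρ := by
      rcases (mem_jEllipse_iff.1 hmem).lt_or_eq with hlt | heq
      · exact absurd ((mem_interior_jEllipse_iff_of_im_pos h0 h1.le hζ).2 hlt) hnint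
      · exact heq
    obtain ⟨t, ht, rfl⟩ := exists_ellArc_eq h0 h1.le hζ heq
    exact ⟨t, ht, rfl⟩
  · rintro ⟨t, ht, rfl⟩
    refine ⟨ellArc_im_pos h0 h1 ht, ?_⟩
    rw [(isClosed_jEllipse ρ).frontier_eq]
    exact ⟨ellArc_mem_jEllipse h0 t, ellArc_notMem_interior h0 h1.le t⟩

/-- A point of `ℍ` lies in `N(ρ)` for NO `ρ` close to `1`: if `ζ = J(v)`, `‖v‖ < 1`, then
`ζ ∉ N(ρ)` for `ρ > ‖v‖`. [folklore] -/
theorem eventually_notMem_jEllipse {ζ : ℂ} (hζ : 0 < ζ.im) : ∀ᶠ ρ in 𝓝[<] (1 : ℝ), ζ ∉ jEllipse ρ := by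
  obtain ⟨v, hv, rfl⟩ := surjOn_joukowski (show ζ ∈ upperHalfPlaneSet from hζ)
  have hv0 : v ≠ 0 := (lowerHalfDisc_subset hv).2
  have h1 : ∀ᶠ ρ in 𝓝[<] (1 : ℝ), ‖v‖ < ρ := nhdsWithin_le_nhds (Ioi_mem_nhds hv.1)
  have h2 : ∀ᶠ ρ in 𝓝[<] (1 : ℝ), ρ < 1 := self_mem_nhdsWithin
  filter_upwards [h1, h2] with ρ hρ hρ1 hmem
  have := (joukowski_mem_jEllipse_iff ((norm_nonneg v).trans_lt hρ) hρ1.le hv0 hv.1).1 hmem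
  linarith

/-! ### The inverse branch `J⁻¹` on `J(𝔻 ∖ {0}) ⊇ ℂ ∖ [-2, 2]` -/

/-- The punctured unit disc. [folklore] -/
def puncDisc : Set ℂ := ball (0 : ℂ) 1 \ {0}

/-- The punctured disc is open. [folklore] -/
theorem isOpen_puncDisc : IsOpen puncDisc := isOpen_ball.sdiff isClosed_singleton

/-- `J` is holomorphic on the punctured disc. [folklore] -/
theorem differentiableOn_joukowski_puncDisc : DifferentiableOn ℂ joukowski puncDisc :=
  fun _ hv ↦ (differentiableAt_joukowski hv.2).differentiableWithinAt

/-- The image `W = J(𝔻 ∖ {0})`, the domain of the inverse branch. [folklore] -/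
def jImage : Set ℂ := joukowski '' puncDisc

/-- `W` is open. [folklore] -/
theorem isOpen_jImage : IsOpen jImage :=
  Complex.isOpen_image_of_deriv_ne_zero isOpen_puncDisc differentiableOn_joukowski_puncDisc
    fun _ hv ↦ deriv_joukowski_ne_zero (mem_ball_zero_iff.1 hv.1) hv.2

/-- `ℍ ⊆ W`. [folklore] -/
theorem upperHalfPlaneSet_subset_jImage : upperHalfPlaneSet ⊆ jImage := fun _ hu ↦ by
  obtain ⟨v, hv, rfl⟩ := surjOn_joukowski hu
  exact ⟨v, lowerHalfDisc_subset hv, rfl⟩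

/-- **The inverse branch `J⁻¹ : W → 𝔻 ∖ {0}`** of the Joukowski map (junk off `W`). [folklore] -/
def jInv : ℂ → ℂ := Function.invFunOn joukowski puncDisc

/-- `J⁻¹` is holomorphic on `W`. [folklore] -/
theorem differentiableOn_jInv : DifferentiableOn ℂ jInv jImage :=
  Complex.differentiableOn_invFunOn_image isOpen_puncDisc differentiableOn_joukowski_puncDisc
    (injOn_joukowski.mono fun _ h ↦ h) fun _ hv ↦ deriv_joukowski_ne_zero (mem_ball_zero_iff.1 hv.1) hv.2

/-- `J⁻¹` is holomorphic at every point of `W`. [folklore] -/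
theorem differentiableAt_jInv {u : ℂ} (hu : u ∈ jImage) : DifferentiableAt ℂ jInv u :=
  (differentiableOn_jInv u hu).differentiableAt (isOpen_jImage.mem_nhds hu)

/-- `J (J⁻¹ u) = u` on `W`. [folklore] -/
theorem joukowski_jInv {u : ℂ} (hu : u ∈ jImage) : joukowski (jInv u) = u :=
  Function.invFunOn_eq hu

/-- `J⁻¹ u ∈ 𝔻 ∖ {0}` for `u ∈ W`. [folklore] -/
theorem jInv_mem {u : ℂ} (hu : u ∈ jImage) : jInv u ∈ puncDisc := Function.invFunOn_mem hu

/-- `J⁻¹ u ≠ 0`. [folklore] -/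
theorem jInv_ne_zero {u : ℂ} (hu : u ∈ jImage) : jInv u ≠ 0 := (jInv_mem hu).2

/-- `‖J⁻¹ u‖ < 1`. [folklore] -/
theorem norm_jInv_lt_one {u : ℂ} (hu : u ∈ jImage) : ‖jInv u‖ < 1 := mem_ball_zero_iff.1 (jInv_mem hu).1

/-- `J⁻¹ (J v) = v` on the punctured disc. [folklore] -/
theorem jInv_joukowski {v : ℂ} (hv : v ∈ puncDisc) : jInv (joukowski v) = v :=
  (injOn_joukowski.mono fun _ h ↦ h).leftInvOn_invFunOn hv

/-- `J⁻¹` maps `ℍ` into the lower half-disc. [folklore] -/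
theorem jInv_mem_lowerHalfDisc {u : ℂ} (hu : u ∈ upperHalfPlaneSet) : jInv u ∈ lowerHalfDisc := by
  obtain ⟨v, hv, rfl⟩ := surjOn_joukowski hu
  rwa [jInv_joukowski (lowerHalfDisc_subset hv)]

/-- `J⁻¹` maps `ℍ ∖ N(ρ)` into the lower disc of radius `ρ`. [folklore] -/
theorem jInv_mem_lowerDisc {ρ : ℝ} (h0 : 0 < ρ) (h1 : ρ ≤ 1) {u : ℂ} (hu : u ∈ upperHalfPlaneSet \ jEllipse ρ) :
    jInv u ∈ lowerDisc ρ := by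
  obtain ⟨v, hv, rfl⟩ := (bijOn_joukowski_lowerDisc h0 h1).surjOn hu
  rwa [jInv_joukowski (lowerHalfDisc_subset (lowerDisc_subset_lowerHalfDisc h1 hv))]

/-- **`J⁻¹` maps `ℍ ∖ N(ρ)` bijectively onto the lower disc of radius `ρ`.** [folklore] -/
theorem bijOn_jInv {ρ : ℝ} (h0 : 0 < ρ) (h1 : ρ ≤ 1) : BijOn jInv (upperHalfPlaneSet \ jEllipse ρ) (lowerDisc ρ) := by
  refine ⟨fun u hu ↦ jInv_mem_lowerDisc h0 h1 hu, fun u hu u' hu' h ↦ ?_, fun v hv ↦ ?_⟩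
  · rw [← joukowski_jInv (upperHalfPlaneSet_subset_jImage hu.1), h,
      joukowski_jInv (upperHalfPlaneSet_subset_jImage hu'.1)]
  · exact ⟨joukowski v, (bijOn_joukowski_lowerDisc h0 h1).mapsTo hv,
      jInv_joukowski (lowerHalfDisc_subset (lowerDisc_subset_lowerHalfDisc h1 hv))⟩

/-- **`‖J⁻¹ u‖ < (‖u‖ - 1)⁻¹`** for `‖u‖ > 1`: `J⁻¹ u → 0` as `u → ∞`. [folklore] -/
theorem norm_jInv_lt {u : ℂ} (hu : u ∈ jImage) (h : 1 < ‖u‖) : ‖jInv u‖ < (‖u‖ - 1)⁻¹ := by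
  set v := jInv u with hv
  have hv0 : v ≠ 0 := jInv_ne_zero hu
  have hv1 : ‖v‖ < 1 := norm_jInv_lt_one hu
  have hvpos : 0 < ‖v‖ := norm_pos_iff.2 hv0
  have hJ : joukowski v = u := joukowski_jInv hu
  have h1 : ‖u‖ ≤ ‖v‖ + ‖v‖⁻¹ := by
    rw [← hJ, joukowski, ← norm_inv]
    exact norm_add_le _ _
  have h2 : ‖u‖ - 1 < ‖v‖⁻¹ := by linarith
  exact (lt_inv_comm₀ hvpos (by linarith)).2 h2

/-- **Derivative of the inverse branch**: `(J⁻¹)'(u) = (1 - (J⁻¹ u)⁻²)⁻¹`. [folklore] -/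
theorem hasDerivAt_jInv {u : ℂ} (hu : u ∈ jImage) : HasDerivAt jInv (1 - (jInv u ^ 2)⁻¹)⁻¹ u := by
  refine HasDerivAt.of_local_left_inverse (differentiableAt_jInv hu).continuousAt
    (hasDerivAt_joukowski (jInv_ne_zero hu)) ?_ ?_
  · rw [← deriv_joukowski (jInv_ne_zero hu)]
    exact deriv_joukowski_ne_zero (norm_jInv_lt_one hu) (jInv_ne_zero hu)
  · filter_upwards [isOpen_jImage.mem_nhds hu] with y hy
    exact joukowski_jInv hy

/-- `1 - v⁻² ≠ 0` on the punctured disc. [folklore] -/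
theorem one_sub_inv_sq_ne_zero {v : ℂ} (hv0 : v ≠ 0) (hv1 : ‖v‖ < 1) : (1 : ℂ) - (v ^ 2)⁻¹ ≠ 0 := by
  rw [← deriv_joukowski hv0]
  exact deriv_joukowski_ne_zero hv1 hv0

/-- **Real points `x < -2` are in `W`, with `J⁻¹ x ∈ (-1, 0)` real**: the root
`v = (x + √(x² - 4))/2` of `v + v⁻¹ = x` in the disc. [folklore] -/
theorem jInv_ofReal_of_lt {x : ℝ} (hx : x < -2) :
    ∃ v : ℝ, -1 < v ∧ v < 0 ∧ (x : ℂ) ∈ jImage ∧ jInv x = v ∧ v + v⁻¹ = x := by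
  set s : ℝ := Real.sqrt (x ^ 2 - 4) with hs
  have hx2 : 0 < x ^ 2 - 4 := by nlinarith
  have hs0 : 0 ≤ s := Real.sqrt_nonneg _
  have hss : s ^ 2 = x ^ 2 - 4 := Real.sq_sqrt hx2.le
  have hsx : s < -x := by nlinarith
  set v : ℝ := (x + s) / 2 with hv
  have hvneg : v < 0 := by rw [hv]; linarith
  have hv1 : -1 < v := by
    rw [hv]
    have : -x - 2 < s := by nlinarith
    linarith
  have hv0 : v ≠ 0 := hvneg.ne
  have hvinv : v⁻¹ = (x - s) / 2 := by
    have h4 : (x + s) * (x - s) = 4 := by nlinarith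
    refine inv_eq_of_mul_eq_one_right ?_
    rw [hv]
    linear_combination (1 / 4 : ℝ) * h4
  have hJ : v + v⁻¹ = x := by rw [hvinv, hv]; ring
  have hvD : (v : ℂ) ∈ puncDisc := by
    refine ⟨mem_ball_zero_iff.2 ?_, ?_⟩
    · rw [norm_real, Real.norm_eq_abs, abs_lt]
      exact ⟨hv1, by linarith⟩
    · rw [mem_singleton_iff]
      exact_mod_cast hv0
  have hJc : joukowski (v : ℂ) = x := by
    rw [joukowski, ← ofReal_inv, ← ofReal_add, hJ]
  refine ⟨v, hv1, hvneg, ⟨v, hvD, hJc⟩, ?_, hJ⟩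
  rw [← hJc, jInv_joukowski hvD]

/-! ### The normalised maps `G_ρ(u) = J⁻¹(u)/ρ² + 1/J⁻¹(u)` -/

/-- **The normalised map `G_ρ`** of the half-ellipse `N(ρ) ∩ ℍ̄`: `G_ρ(u) = ρ⁻¹ J(J⁻¹(u)/ρ) =
J⁻¹(u)/ρ² + 1/J⁻¹(u)`, a conformal map `ℍ ∖ N(ρ) → ℍ` with `G_ρ(u)/u → 1` at `∞`. [folklore] -/
def jNorm (ρ : ℝ) (u : ℂ) : ℂ := jInv u / ((ρ : ℂ) ^ 2) + (jInv u)⁻¹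

/-- `G_ρ(u) = J(J⁻¹(u)/ρ)/ρ` on `W`. [folklore] -/
theorem jNorm_eq {ρ : ℝ} (h0 : ρ ≠ 0) {u : ℂ} (hu : u ∈ jImage) : jNorm ρ u = joukowski (jInv u / ρ) / ρ := by
  rw [jNorm, joukowski]
  have hv0 := jInv_ne_zero hu
  have hρ0 : (ρ : ℂ) ≠ 0 := ofReal_ne_zero.2 h0
  field_simp

/-- **`G_ρ(u) - u = J⁻¹(u) (ρ⁻² - 1)`** on `W`. [folklore] -/
theorem jNorm_sub (ρ : ℝ) {u : ℂ} (hu : u ∈ jImage) :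
    jNorm ρ u - u = jInv u * (((ρ : ℂ) ^ 2)⁻¹ - 1) := by
  have hJ := joukowski_jInv hu
  calc jNorm ρ u - u = jNorm ρ u - joukowski (jInv u) := by rw [hJ]
    _ = jInv u * (((ρ : ℂ) ^ 2)⁻¹ - 1) := by
        rw [jNorm, joukowski]
        ring

/-- **The uniform bound `‖G_ρ(u) - u‖ ≤ ‖J⁻¹ u‖ (ρ⁻² - 1)`** (`ρ ∈ (0, 1]`). [folklore] -/
theorem norm_jNorm_sub_le {ρ : ℝ} (h0 : 0 < ρ) (h1 : ρ ≤ 1) {u : ℂ} (hu : u ∈ jImage) :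
    ‖jNorm ρ u - u‖ ≤ ‖jInv u‖ * ((ρ ^ 2)⁻¹ - 1) := by
  rw [jNorm_sub ρ hu, norm_mul]
  refine mul_le_mul_of_nonneg_left ?_ (norm_nonneg _)
  have h2 : (((ρ : ℂ) ^ 2)⁻¹ - 1) = (((ρ ^ 2)⁻¹ - 1 : ℝ) : ℂ) := by push_cast; ring
  have h3 : 0 ≤ (ρ ^ 2)⁻¹ - 1 := by
    have : ρ ^ 2 ≤ 1 := by nlinarith
    have := (one_le_inv₀ (by positivity)).2 this
    linarith
  rw [h2, norm_real, Real.norm_of_nonneg h3]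

/-- `G_ρ` is holomorphic on `W`, with derivative `(ρ⁻² - v⁻²)(1 - v⁻²)⁻¹`, `v = J⁻¹ u`. [folklore] -/
theorem hasDerivAt_jNorm {ρ : ℝ} {u : ℂ} (hu : u ∈ jImage) :
    HasDerivAt (jNorm ρ) ((((ρ : ℂ) ^ 2)⁻¹ - (jInv u ^ 2)⁻¹) * (1 - (jInv u ^ 2)⁻¹)⁻¹) u := by
  have h1 := hasDerivAt_jInv hu
  have hv0 := jInv_ne_zero hu
  have h2 : HasDerivAt (fun u ↦ jInv u / ((ρ : ℂ) ^ 2)) ((1 - (jInv u ^ 2)⁻¹)⁻¹ / ((ρ : ℂ) ^ 2)) u :=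
    h1.div_const _
  have h3 : HasDerivAt (fun u ↦ (jInv u)⁻¹) (-(jInv u ^ 2)⁻¹ * (1 - (jInv u ^ 2)⁻¹)⁻¹) u :=
    (hasDerivAt_inv hv0).comp u h1
  have h4 : HasDerivAt (jNorm ρ) ((1 - (jInv u ^ 2)⁻¹)⁻¹ / ((ρ : ℂ) ^ 2) +
      -(jInv u ^ 2)⁻¹ * (1 - (jInv u ^ 2)⁻¹)⁻¹) u := h2.add h3
  refine h4.congr_deriv ?_
  ring

/-- `G_ρ` is holomorphic on `W`. [folklore] -/
theorem differentiableOn_jNorm (ρ : ℝ) : DifferentiableOn ℂ (jNorm ρ) jImage :=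
  fun _ hu ↦ (hasDerivAt_jNorm hu).differentiableAt.differentiableWithinAt

/-- `G_ρ` is holomorphic at points of `W`. [folklore] -/
theorem differentiableAt_jNorm (ρ : ℝ) {u : ℂ} (hu : u ∈ jImage) : DifferentiableAt ℂ (jNorm ρ) u :=
  (hasDerivAt_jNorm hu).differentiableAt

/-- The derivative of `G_ρ`. [folklore] -/
theorem deriv_jNorm {ρ : ℝ} {u : ℂ} (hu : u ∈ jImage) :
    deriv (jNorm ρ) u = (((ρ : ℂ) ^ 2)⁻¹ - (jInv u ^ 2)⁻¹) * (1 - (jInv u ^ 2)⁻¹)⁻¹ :=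
  (hasDerivAt_jNorm hu).deriv

/-- `G_ρ' ≠ 0` where `‖J⁻¹ u‖ < ρ`. [folklore] -/
theorem deriv_jNorm_ne_zero {ρ : ℝ} (h0 : 0 < ρ) {u : ℂ} (hu : u ∈ jImage) (hρ : ‖jInv u‖ < ρ) :
    deriv (jNorm ρ) u ≠ 0 := by
  rw [deriv_jNorm hu]
  have hv0 := jInv_ne_zero hu
  refine mul_ne_zero ?_ (inv_ne_zero (one_sub_inv_sq_ne_zero hv0 (norm_jInv_lt_one hu)))
  intro h
  have h1 : jInv u ^ 2 = (ρ : ℂ) ^ 2 := by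
    have := sub_eq_zero.1 h
    rw [inv_eq_iff_eq_inv, inv_inv] at this
    exact this.symm
  have : ‖jInv u‖ ^ 2 = ρ ^ 2 := by
    rw [← norm_pow, h1, norm_pow, norm_real, Real.norm_of_nonneg h0.le]
  nlinarith [norm_nonneg (jInv u)]

/-- **`G_ρ` maps `ℍ ∖ N(ρ)` bijectively onto `ℍ`** (`J⁻¹`, then `v ↦ v/ρ` onto the lower unit
half-disc, then `J` onto `ℍ`, then `· / ρ`). [folklore] -/
theorem bijOn_jNorm {ρ : ℝ} (h0 : 0 < ρ) (h1 : ρ ≤ 1) : BijOn (jNorm ρ) (upperHalfPlaneSet \ jEllipse ρ) upperHalfPlaneSet := by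
  have hρ0 : (ρ : ℂ) ≠ 0 := ofReal_ne_zero.2 h0.ne'
  have hscale : ∀ {v : ℂ}, v ∈ lowerDisc ρ → v / ρ ∈ lowerHalfDisc := fun {v} hv ↦ by
    refine ⟨?_, ?_⟩
    · rw [norm_div, norm_real, Real.norm_of_nonneg h0.le, div_lt_one h0]
      exact hv.1
    · rw [div_ofReal_im]
      exact div_neg_of_neg_of_pos hv.2 h0
  refine ⟨fun u hu ↦ ?_, fun u hu u' hu' h ↦ ?_, fun ζ hζ ↦ ?_⟩
  · rw [jNorm_eq h0.ne' (upperHalfPlaneSet_subset_jImage hu.1)]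
    show 0 < (joukowski (jInv u / ρ) / ρ).im
    rw [div_ofReal_im]
    exact div_pos (mapsTo_joukowski (hscale (jInv_mem_lowerDisc h0 h1 hu))) h0
  · rw [jNorm_eq h0.ne' (upperHalfPlaneSet_subset_jImage hu.1),
      jNorm_eq h0.ne' (upperHalfPlaneSet_subset_jImage hu'.1)] at h
    have h2 : joukowski (jInv u / ρ) = joukowski (jInv u' / ρ) := by
      have := congrArg (· * (ρ : ℂ)) h
      simpa [div_mul_cancel₀ _ hρ0] using this
    have h3 := injOn_joukowski (lowerHalfDisc_subset (hscale (jInv_mem_lowerDisc h0 h1 hu)))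
      (lowerHalfDisc_subset (hscale (jInv_mem_lowerDisc h0 h1 hu'))) h2
    have h4 : jInv u = jInv u' := by
      have := congrArg (· * (ρ : ℂ)) h3
      simpa [div_mul_cancel₀ _ hρ0] using this
    exact (bijOn_jInv h0 h1).injOn hu hu' h4
  · -- `ρ ζ = J(w)`, `w` in the lower unit half-disc; `u = J(ρ w)`
    have hρζ : (ρ : ℂ) * ζ ∈ upperHalfPlaneSet := by
      show 0 < ((ρ : ℂ) * ζ).im
      rw [im_ofReal_mul]
      exact mul_pos h0 hζ
    obtain ⟨w, hw, hwζ⟩ := surjOn_joukowski hρζ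
    have hv : (ρ : ℂ) * w ∈ lowerDisc ρ := by
      refine ⟨?_, ?_⟩
      · rw [norm_mul, norm_real, Real.norm_of_nonneg h0.le]
        calc ρ * ‖w‖ < ρ * 1 := mul_lt_mul_of_pos_left hw.1 h0
          _ = ρ := mul_one ρ
      · rw [im_ofReal_mul]
        exact mul_neg_of_pos_of_neg h0 hw.2
    have hvD : (ρ : ℂ) * w ∈ puncDisc := lowerHalfDisc_subset (lowerDisc_subset_lowerHalfDisc h1 hv)
    refine ⟨joukowski ((ρ : ℂ) * w), (bijOn_joukowski_lowerDisc h0 h1).mapsTo hv, ?_⟩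
    rw [jNorm_eq h0.ne' ⟨_, hvD, rfl⟩, jInv_joukowski hvD,
      mul_div_cancel_left₀ _ hρ0, hwζ, mul_div_cancel_left₀ _ hρ0]

/-- **`G_ρ(u)/u → 1` as `u → ∞` in `W`** (`G_ρ(u) - u = J⁻¹(u)(ρ⁻² - 1)` with `‖J⁻¹ u‖ < 1`). [folklore] -/
theorem tendsto_jNorm_div {ρ : ℝ} (h0 : 0 < ρ) (h1 : ρ ≤ 1) :
    Tendsto (fun u ↦ jNorm ρ u / u) (cocompact ℂ ⊓ 𝓟 jImage) (𝓝 1) := by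
  have hC : 0 ≤ (ρ ^ 2)⁻¹ - 1 := by
    have : ρ ^ 2 ≤ 1 := by nlinarith
    have := (one_le_inv₀ (by positivity)).2 this
    linarith
  rw [Metric.tendsto_nhds]
  intro ε hε
  have hev : ∀ᶠ u in cocompact ℂ ⊓ 𝓟 jImage, ((ρ ^ 2)⁻¹ - 1) / ε + 1 ≤ ‖u‖ ∧ u ∈ jImage := by
    refine Filter.eventually_inf_principal.2 ?_
    rw [← cobounded_eq_cocompact]
    filter_upwards [(Filter.hasBasis_cobounded_norm (E := ℂ)).mem_of_mem (i := ((ρ ^ 2)⁻¹ - 1) / ε + 1) trivial]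
      with u hu hu'
    exact ⟨hu, hu'⟩
  filter_upwards [hev] with u ⟨hu, huW⟩
  have hupos : 0 < ‖u‖ := by
    have : 0 ≤ ((ρ ^ 2)⁻¹ - 1) / ε := div_nonneg hC hε.le
    linarith
  have hu0 : u ≠ 0 := norm_pos_iff.1 hupos
  rw [dist_eq_norm, show jNorm ρ u / u - 1 = (jNorm ρ u - u) / u by field_simp, norm_div]
  have h2 := norm_jNorm_sub_le h0 h1 huW
  have h3 : ‖jInv u‖ * ((ρ ^ 2)⁻¹ - 1) ≤ (ρ ^ 2)⁻¹ - 1 := by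
    have := norm_jInv_lt_one huW
    nlinarith
  rw [div_lt_iff₀ hupos]
  have h4 : (ρ ^ 2)⁻¹ - 1 < ε * ‖u‖ := by
    have : ((ρ ^ 2)⁻¹ - 1) / ε < ‖u‖ := by linarith
    rwa [div_lt_iff₀' hε] at this
  linarith

/-- **At a real point `x < -(ρ + ρ⁻¹)`**: `J⁻¹ x = v₀ ∈ (-ρ, 0)` is real, `G_ρ(x)` is real, and
`G_ρ'(x) = (1 - v₀²/ρ²)/(1 - v₀²) ∈ (0, 1]`... packaged: the real data at `x`. [folklore] -/
theorem jNorm_ofReal_data {ρ x : ℝ} (h0 : 0 < ρ) (h1 : ρ ≤ 1) (hx : x < -jLevel ρ) :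
    ∃ v : ℝ, -ρ < v ∧ v < 0 ∧ (x : ℂ) ∈ jImage ∧ jInv x = v ∧
      jNorm ρ x = ((v / ρ ^ 2 + v⁻¹ : ℝ) : ℂ) ∧
      deriv (jNorm ρ) x = (((1 - v ^ 2 / ρ ^ 2) / (1 - v ^ 2) : ℝ) : ℂ) := by
  have hx2 : x < -2 := by linarith [two_le_jLevel h0 h1]
  obtain ⟨v, hv1, hv0, hxW, hjx, hJ⟩ := jInv_ofReal_of_lt hx2
  -- `|v| < ρ` from `|v| + |v|⁻¹ = -x > ρ + ρ⁻¹`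
  have hvρ : -ρ < v := by
    have hlev : jLevel (-v) = -x := by
      rw [jLevel, ← hJ, inv_neg]
      ring
    by_contra hle
    push Not at hle
    have hρv : ρ ≤ -v := by linarith
    have := jLevel_le_jLevel h0 hρv (by linarith)
    linarith
  refine ⟨v, hvρ, hv0, hxW, hjx, ?_, ?_⟩
  · rw [jNorm, hjx]
    push_cast
    ring
  · rw [deriv_jNorm hxW, hjx]
    have hv0' : (v : ℂ) ≠ 0 := ofReal_ne_zero.2 hv0.ne
    have hρ0 : (ρ : ℂ) ≠ 0 := ofReal_ne_zero.2 h0.ne'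
    have h1v' : (1 : ℝ) - v ^ 2 ≠ 0 := by nlinarith
    have hc : (1 : ℂ) - (v : ℂ) ^ 2 ≠ 0 := by exact_mod_cast h1v'
    have hc' : (v : ℂ) ^ 2 - 1 ≠ 0 := fun h ↦ hc (by linear_combination -h)
    have hc'' : -1 + (v : ℂ) ^ 2 ≠ 0 := fun h ↦ hc (by linear_combination -h)
    have hv2 : (v : ℂ) ^ 2 ≠ 0 := pow_ne_zero 2 hv0'
    have e1 : (1 : ℂ) - ((v : ℂ) ^ 2)⁻¹ = ((v : ℂ) ^ 2 - 1) / (v : ℂ) ^ 2 := by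
      field_simp
    have e2 : ((ρ : ℂ) ^ 2)⁻¹ - ((v : ℂ) ^ 2)⁻¹ = ((v : ℂ) ^ 2 - (ρ : ℂ) ^ 2) / ((ρ : ℂ) ^ 2 * (v : ℂ) ^ 2) := by
      field_simp
    have key : ((((ρ : ℂ) ^ 2)⁻¹ - ((v : ℂ) ^ 2)⁻¹) * (1 - ((v : ℂ) ^ 2)⁻¹)⁻¹) =
        (1 - (v : ℂ) ^ 2 / (ρ : ℂ) ^ 2) / (1 - (v : ℂ) ^ 2) := by
      rw [e1, e2, inv_div, div_mul_div_comm, div_eq_div_iff (by positivity) hc]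
      field_simp
      ring
    rw [key]
    push_cast
    ring

end Literature.Probability.RandomPlanarGeometry
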